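import Summits.KontsevichZagierPeriods.Zeta5Search.Barrier.ConeGammaPairs

/-!
# ζ(5) search — BARRIER: `δ₂₈` is Lipschitz with constant `5` in the forms (`10` in the height-one parameters)

HONEST FRAMING (cell `pub-zeta5`): systematic search; no irrationality claim unless kernel-certified. MODEL objects
under Brown–Zudilin's (28)+(30) accounting ([BZ22] = arXiv:2210.03391); nothing here is a statement about `ζ(5)`;
records in print UNMOVED. One of the «certifiable `L`'s» of `BARRIER-PLAN.md` §2b (theory seat cert-2 g17): the
(28)-exponent `δ₂₈ = m₁+⋯+m₅` (maximum over 5-element index sets of `Σ h_i`) moves by at most `5·max_k |Δh_k|`,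
and each pair form moves by at most twice the sup-distance of the symmetric parameters, so
`|δ₂₈(a) − δ₂₈(a')| ≤ 10·max_i |s_i(a) − s_i(a')|` (`L_δ = 10` in `s₀ = 1` units, slopes `≤ 5` per form pair).

* `delta28_le_add_of_forms_le` — `h_k(a) ≤ h_k(a') + M ∀k ⇒ δ₂₈(a) ≤ δ₂₈(a') + 5M`;
* **`abs_delta28_sub_le_forms`** — `|δ₂₈(a) − δ₂₈(a')| ≤ 5·M` whenever `|h_k(a) − h_k(a')| ≤ M` for all `k`;
* **`abs_delta28_sub_le_sParam`** — `|δ₂₈(a) − δ₂₈(a')| ≤ 10·M` whenever `|s_i(a) − s_i(a')| ≤ M` for all `i`.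
-/

noncomputable section

open Set

namespace Summit.KontsevichZagierPeriods.Zeta5Search.Barrier.ConeGamma

/-- One-sided form: if every form of `a` is at most the corresponding form of `a'` plus `M`, then
`δ₂₈(a) ≤ δ₂₈(a') + 5M`. -/
theorem delta28_le_add_of_forms_le {a a' : Dir} {M : ℝ} (h : ∀ k : Fin 28, h28 a k ≤ h28 a' k + M) :
    delta28 a ≤ delta28 a' + 5 * M := by
  unfold delta28
  refine Finset.sup'_le _ _ fun S hS => ?_
  have hcard : S.card = 5 := (Finset.mem_powersetCard.mp hS).2
  calc ∑ i ∈ S, h28 a i ≤ ∑ i ∈ S, (h28 a' i + M) := Finset.sum_le_sum fun i _ => h i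
    _ = ∑ i ∈ S, h28 a' i + 5 * M := by
        rw [Finset.sum_add_distrib, Finset.sum_const, hcard]; simp
    _ ≤ _ := by
        have := Finset.le_sup' (fun S => ∑ i ∈ S, h28 a' i) hS
        linarith

/-- **`δ₂₈` is 5-Lipschitz in the sup-distance of the 28 forms**: `|δ₂₈(a) − δ₂₈(a')| ≤ 5·max_k |h_k(a) − h_k(a')|`. -/
theorem abs_delta28_sub_le_forms {a a' : Dir} {M : ℝ} (h : ∀ k : Fin 28, |h28 a k - h28 a' k| ≤ M) :
    |delta28 a - delta28 a'| ≤ 5 * M := by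
  rw [abs_le]
  constructor
  · have := delta28_le_add_of_forms_le (a := a') (a' := a) (M := M) fun k => by
      have := (abs_le.mp (h k)).1; linarith
    linarith
  · have := delta28_le_add_of_forms_le (a := a) (a' := a') (M := M) fun k => by
      have := (abs_le.mp (h k)).2; linarith
    linarith

/-- Each pair form moves by at most twice the sup-distance of the symmetric parameters. -/
theorem abs_pairForm_sub_le {s s' : Fin 8 → ℝ} {M : ℝ} (h : ∀ i : Fin 8, |s i - s' i| ≤ M) (i j : Fin 8) :
    |pairForm s i j - pairForm s' i j| ≤ 2 * M := by
  have hM : 0 ≤ M := (abs_nonneg _).trans (h 0)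
  unfold pairForm
  split_ifs with h1 h2
  · have e : s 0 - s j - (s' 0 - s' j) = (s 0 - s' 0) - (s j - s' j) := by ring
    rw [e]
    exact (abs_sub _ _).trans (by linarith [h 0, h j])
  · have e : s 0 - s i - (s' 0 - s' i) = (s 0 - s' 0) - (s i - s' i) := by ring
    rw [e]
    exact (abs_sub _ _).trans (by linarith [h 0, h i])
  · have e : s i + s j - (s' i + s' j) = (s i - s' i) + (s j - s' j) := by ring
    rw [e]
    exact (abs_add_le _ _).trans (by linarith [h i, h j])

/-- **`δ₂₈` is 10-Lipschitz in the sup-distance of the symmetric parameters** (`L_δ = 10` per unit `‖Δs‖∞`; at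
height one, `‖Δt‖∞`): `|δ₂₈(a) − δ₂₈(a')| ≤ 10·M` if `|s_i(a) − s_i(a')| ≤ M` for all `i`. -/
theorem abs_delta28_sub_le_sParam {a a' : Dir} {M : ℝ} (h : ∀ i : Fin 8, |sParam a i - sParam a' i| ≤ M) :
    |delta28 a - delta28 a'| ≤ 10 * M := by
  have hforms : ∀ k : Fin 28, |h28 a k - h28 a' k| ≤ 2 * M := by
    intro k
    have ha : h28 a k = phiForm (sParam a) k := by
      rw [← one_mul (h28 a k), ← phiForm_smul_sParam, one_smul]
    have ha' : h28 a' k = phiForm (sParam a') k := by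
      rw [← one_mul (h28 a' k), ← phiForm_smul_sParam, one_smul]
    rw [ha, ha', phiForm_eq, phiForm_eq]
    exact abs_pairForm_sub_le h _ _
  have := abs_delta28_sub_le_forms hforms
  linarith

end Summit.KontsevichZagierPeriods.Zeta5Search.Barrier.ConeGamma

end
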